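import Literature.AlgebraicGeometry.RelativeSpec.FiniteGroupQuotientGluing
import Mathlib.AlgebraicGeometry.Limits
import HarnessLib

/-!
# Mumford's hypothesis from quasi-projectivity: orbits in affine opens give a cover by stable
# opens affine over the base

Route `ResolutionOfSingularities/WildQuotients`, support items `GaloisReduction`
(stmt-ResolutionOfSingularities-15641) and `GaloisQuotientAlteration`
(stmt-ResolutionOfSingularities-16323). The named fact
`Literature.AlgebraicGeometry.Resolution.DeJong1997_galoisAlterationQuasiProjective` records the
quasi-projectivity of de Jong's Galois alteration `X′` as "every finite set of points of `X′` lies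
in an affine open"; the glued quotient `X′/G` of
`Literature.AlgebraicGeometry.RelativeSpec.FiniteGroupQuotientGluing` (`ActionOver.glued`,
`gluedMk hcov`) wants `hcov`: every point lies in a `G`-STABLE open AFFINE OVER THE BASE `X`.
This file PROVES the passage (Mumford, *Abelian Varieties*, §7, proof of the Thm. p. 66: "the
orbit of any point is contained in an affine open … `X` is covered by `G`-stable affine opens",
the intersection of the translates):

* `isAffineHom_of_isAffine_of_isSeparated` — a morphism from an affine scheme to a separated
  scheme is affine (its graph is a closed immersion into `O × X`, whose projection to `X` is
  affine);
* `exists_stableAffineOpens_mem` — for a finite group acting on a separated `X′` over a separated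
  `X`, if every finite subset of `X′` lies in an affine open then every point lies in a `G`-stable
  open affine over `X` (`⋂_g g⁻¹U` for an affine open `U ⊇ G·x`), i.e. the hypothesis `hcov` of
  `ActionOver.gluedMk`.
-/

-- single-problem summit: the doubled namespace component `ResolutionOfSingularities` is forced
set_option linter.dupNamespace false

noncomputable section

open CategoryTheory Limits AlgebraicGeometry

namespace Summit.ResolutionOfSingularities.ResolutionOfSingularities.Theorems

open Literature.AlgebraicGeometry.RelativeSpec

universe u

/-- **A morphism from an affine scheme to a separated scheme is affine**: `f : O → X` factors as
the graph `O → O × X` — a closed immersion, being a section of the separated projection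
`O × X → O` — followed by the projection `O × X → X`, which is affine as the base change of
`O → Spec ℤ`. [folklore] -/
theorem isAffineHom_of_isAffine_of_isSeparated {O X : Scheme.{u}} (f : O ⟶ X) [IsAffine O]
    [X.IsSeparated] : IsAffineHom f := by
  haveI : IsAffineHom (terminal.from O) :=
    (HasAffineProperty.iff_of_isAffine (P := @IsAffineHom)).mpr inferInstance
  let gr : O ⟶ pullback (terminal.from O) (terminal.from X) :=
    pullback.lift (𝟙 O) f (terminal.hom_ext _ _)
  have hgr1 : gr ≫ pullback.fst _ _ = 𝟙 O := pullback.lift_fst _ _ _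
  have hgr2 : gr ≫ pullback.snd _ _ = f := pullback.lift_snd _ _ _
  haveI : IsClosedImmersion (gr ≫ pullback.fst (terminal.from O) (terminal.from X)) := by
    rw [hgr1]
    infer_instance
  haveI : IsClosedImmersion gr :=
    IsClosedImmersion.of_comp gr (pullback.fst (terminal.from O) (terminal.from X))
  haveI : IsAffineHom (pullback.snd (terminal.from O) (terminal.from X)) :=
    MorphismProperty.pullback_snd _ _ inferInstance
  rw [← hgr2]
  infer_instance

variable {X' X : Scheme.{u}} {π : X' ⟶ X} {G : Type u} [Group G] [Finite G] (ρ : ActionOver π G)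

omit [Finite G] in
/-- The translate of an affine open by an automorphism of the action is affine. [folklore] -/
theorem isAffineOpen_aut_preimage {U : X'.Opens} (hU : IsAffineOpen U) (g : G) :
    IsAffineOpen ((ρ.aut g).hom ⁻¹ᵁ U) :=
  hU.preimage (ρ.aut g).hom

/-- **Mumford's hypothesis from "finite subsets lie in affine opens"** (Mumford, *Abelian
Varieties*, §7, proof of the Thm. p. 66: cover `X` by the `G`-stable affine opens `⋂_g g U_α`).
Let the finite group `G` act on the separated `X′` over the separated `X` (`ρ : ActionOver π G`)
and suppose every finite set of points of `X′` lies in an affine open (e.g. `X′` quasi-projective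
over a field — the clause of `DeJong1997_galoisAlterationQuasiProjective`). Then every `x ∈ X′`
lies in a `G`-stable open which is affine over `X`: with `U ⊇ G·x` affine,
`O = ⋂_{g ∈ G} g⁻¹U` is `G`-stable, affine (a finite intersection of affine opens of a separated
scheme) and `O → X` is affine (`isAffineHom_of_isAffine_of_isSeparated`). This is the hypothesis
`hcov` of `ActionOver.gluedMk`. [cite: MumfordAV1970, §7 Thm. p. 66 (proof)] -/
theorem exists_stableAffineOpens_mem [X'.IsSeparated] [X.IsSeparated]
    (hfin : ∀ S : Finset X', ∃ U : X'.Opens, IsAffineOpen U ∧ (↑S : Set X') ⊆ U) (x : X') :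
    ∃ O : ρ.StableAffineOpens, x ∈ O.1 := by
  classical
  let _ : Fintype G := Fintype.ofFinite G
  obtain ⟨U, hU, hSU⟩ := hfin (Finset.univ.image fun g : G => (ρ.aut g).hom x)
  have hmem : ∀ g : G, (ρ.aut g).hom x ∈ U := fun g =>
    hSU (Finset.mem_coe.mpr (Finset.mem_image_of_mem _ (Finset.mem_univ g)))
  let O : X'.Opens := ⨅ g : G, (ρ.aut g).hom ⁻¹ᵁ U
  have hOcoe : ((O : X'.Opens) : Set X') = ⋂ g : G, (ρ.aut g).hom ⁻¹' (U : Set X') := by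
    change (((⨅ g : G, (ρ.aut g).hom ⁻¹ᵁ U) : X'.Opens) : Set X') = _
    rw [TopologicalSpace.Opens.coe_iInf]
    rfl
  -- `x ∈ O`
  have hxO : x ∈ O := by
    change x ∈ ((O : X'.Opens) : Set X')
    rw [hOcoe]
    exact Set.mem_iInter.mpr fun g => hmem g
  -- `O` is `G`-stable
  have hstab : ∀ h : G, (ρ.aut h).hom ⁻¹ᵁ O = O := by
    intro h
    ext1
    rw [TopologicalSpace.Opens.map_coe, hOcoe, Set.preimage_iInter]
    have e : ∀ g : G, (ρ.aut h).hom ⁻¹' ((ρ.aut g).hom ⁻¹' (U : Set X')) =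
        (ρ.aut (g * h)).hom ⁻¹' (U : Set X') := by
      intro g
      rw [← Set.preimage_comp, map_mul, Aut.Aut_mul_def, Iso.trans_hom]
      rfl
    simp_rw [e]
    exact (Equiv.mulRight h).iInf_comp (g := fun g : G => (ρ.aut g).hom ⁻¹' (U : Set X'))
  -- `O` is affine: a finite intersection of affine opens of the separated `X′`
  have hOaff : IsAffineOpen O := IsAffineOpen.iInf fun g => isAffineOpen_aut_preimage ρ hU g
  haveI : IsAffine (O : Scheme.{u}) := hOaff
  haveI : IsAffineHom (O.ι ≫ π) := isAffineHom_of_isAffine_of_isSeparated _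
  exact ⟨⟨O, hstab, inferInstance⟩, hxO⟩

end Summit.ResolutionOfSingularities.ResolutionOfSingularities.Theorems

end
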